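import Literature.Probability.Percolation.TwoSetExchange
import HarnessLib

/-!
# `NoHeavyLowerTail` (stmt-CriticalPhenomena-4575) — HARRIS ON ONE SIDE OF A SEPARATION
# (given `S ↮ T`, two increasing `T`-side connection events are positively correlated)

Support file (prover `prim-hp-4`, hull-port prover #4, LP-duality technique; `--supports stmt-CriticalPhenomena-4575`).
No definitions, no named facts, no sorries.  Companion of `…IsolationExchange` (the mixed-side, negative-correlation case).

`separation_harris`: for vertex sets `S, T`, a vertex `t₀ ∈ T` and vertices `o, v`, with `D = {S ↮ T}` and `μ = prodBernoulli w`,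
    μ(D, T ↔ o) · μ(D, t₀ ↔ v) ≤ μ(D) · μ(D, T ↔ o, t₀ ↔ v),
where `{T ↔ o} = ⋃_{t ∈ T} {t ↔ o}`.  Both events are of type `(−)` for `(C_S, C_T)` (closed under shrinking `C_S` and enlarging
`C_T`), so this is the instance `A₁ = A₂ = univ`, `B₁ = {T ↔ o}`, `B₂ = {t₀ ↔ v}` of the two-set two-cluster exchange inequality
(van den Berg–Häggström–Kahn 2006, Thm. 1.5; the tree's `setTwoClusterExchange`).
USE (memo `run/shared/lean/prim/prim-hp-4/HULLPORT-LP.md` §9, sign condition (Q1) of the three-port certificate `…XZportThreeCore`):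
in the observer's region graph with ports `1, 2, 3`, `S = {1}`, `T = {2,3}`, `t₀ = 2`, `v = 3`:
    P(o ~ {2,3}, 2 ~ 3, 1 ↮ {2,3}) · P(1 ↮ {2,3}) ≥ P(o ~ {2,3}, 1 ↮ {2,3}) · P(2 ~ 3, 1 ↮ {2,3}),
which in atoms reads `P(S_o = {2,3})·P(1|2|3 separated) ≥ (P(o2|1|3) + P(o3|1|2))·P([2] = {2,3})` — the nonnegativity of the
multiplier `α23` of the observer-set row `A[1;{2,3}]`.
-/

noncomputable section

namespace Summit.CriticalPhenomena.PercolationContinuityZ3.Theorems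

open MeasureTheory Set Literature.Probability.LatticeModels Literature.Probability.Percolation
open scoped Classical BigOperators

variable {n : ℕ}

namespace IsolationExchange

/-- **Harris on one side of a separation** (BHK 2006 Thm. 1.5 via `setTwoClusterExchange`, two type-`(−)` events): with
`D = {S ↮ T}`, `t₀ ∈ T`, `μ(D ∩ {T ↔ o}) · μ(D ∩ {t₀ ↔ v}) ≤ μ(D) · μ(D ∩ ({T ↔ o} ∩ {t₀ ↔ v}))`.
[derived from: VandenbergHaggstromKahn2005, Thm. 1.5 (two-set form) — `setTwoClusterExchange`] -/
theorem separation_harris (w : Sym2 (Fin n) → unitInterval) (S T : Set (Fin n)) {t₀ : Fin n} (ht₀ : t₀ ∈ T)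
    (o v : Fin n) :
    (prodBernoulli w).real ({ω : BondConfig (Fin n) | ∀ s ∈ S, ∀ t ∈ T, ¬ (openGraph ω).Reachable s t} ∩
        (⋃ t ∈ T, (openConn t o : Set (BondConfig (Fin n))))) *
      (prodBernoulli w).real ({ω : BondConfig (Fin n) | ∀ s ∈ S, ∀ t ∈ T, ¬ (openGraph ω).Reachable s t} ∩
        (openConn t₀ v : Set (BondConfig (Fin n)))) ≤
    (prodBernoulli w).real {ω : BondConfig (Fin n) | ∀ s ∈ S, ∀ t ∈ T, ¬ (openGraph ω).Reachable s t} *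
      (prodBernoulli w).real ({ω : BondConfig (Fin n) | ∀ s ∈ S, ∀ t ∈ T, ¬ (openGraph ω).Reachable s t} ∩
        ((⋃ t ∈ T, (openConn t o : Set (BondConfig (Fin n)))) ∩ (openConn t₀ v : Set (BondConfig (Fin n))))) := by
  have key := setTwoClusterExchange w S T
    (A₁ := (univ : Set (BondConfig (Fin n)))) (A₂ := (univ : Set (BondConfig (Fin n))))
    (B₁ := ⋃ t ∈ T, (openConn t o : Set (BondConfig (Fin n)))) (B₂ := (openConn t₀ v : Set (BondConfig (Fin n))))
    (fun _ _ _ _ _ => mem_univ _)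
    (fun _ _ _ _ _ => mem_univ _)
    (fun ω ω' hs ht h => TwoSetExchange.typeMinus_biUnion_openConn S T o hs ht h)
    (fun ω ω' hs ht h => TwoSetExchange.typeMinus_openConn_of_mem S T ht₀ v hs ht h)
  simpa only [inter_univ, univ_inter] using key

end IsolationExchange

end Summit.CriticalPhenomena.PercolationContinuityZ3.Theorems
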